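import Literature.MathematicalPhysics.QuantumFieldTheory.Balaban1983to89.Node00.Record13NumericsOfThm1CCMZ

/-!
# NODE 00 (YM-PLAN Track A) — STAGE 13, THE εbg-LETTER EDITION «Z3»: THE WINDOWED COLLARED z-WITNESS FAMILY WITH THE BACKGROUND RADIUS `εbg` AS AN OPEN LETTER
# (`stage12NumericsOfThm1CCMWB`, `θ₁₅ᶜᶜᴹᵂᶻᴮ(j; γ; εbg) = theta13OfThm1CCMWZB …`), ITS `rfl` BRIDGE TO THE LANDED `εbg = 1` MEMBERS, AND THE ROWS G ∕ Z ∕ P12 — LETTER-GENERIC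

Cell `ym-nodeO-ideate`, DEFINER seat `ym-nodeO-def-1` (gen 10).  `--kind definition --supports stmt-QuantumFields-20541` (Literature Node00 lane; count-neutral).  Siblings: «Z1» =
`Node00/Record12NumericsFamilyDictZ.lean` (the Stage-8∕12 Z-makers), «Z2» = `Node00/Record13NumericsOfThm1CCMZ.lean` (the letters `Efl`, `logz`; IMPORTED, nothing re-declared).
APPEND-ONLY discipline: a NEW module; every landed witness is the `εbg = 1` INSTANCE of its Z3 edition BY `rfl` (§2), so no downstream face re-keys.
[I] = [Balaban1987RG1], [III] = [Balaban1988Convergent], [IV] = [Balaban1989LargeFieldI], [V] = [Balaban1989LargeFieldII], [B11] = [Balaban1985Variational].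

WHY.  At every member of the witness family of record `theta13OfThm1CCMW F N j γ ε₀ ε₂₉ B₃ B₃' a₀ a₁` (= `theta13OfThm1CCMWZ … 0 0`, Z2 `theta13OfThm1CCMW_eq_Z`) the background-field
regularity radius of [I] (0.21) is the numerics-of-record PIN `εbg = 1` (`Record12Numerics.stage12NumericsOfRecord`, threaded unchanged through `stage12NumericsOfFamily` →
`stage12NumericsOfThm1CC1` → `…CCM` → `…CCMW`; face `theta13OfThm1CCMW_εbg`, `rfl`), while the cut-off radius `ν.εreg = a₀` and `ν.ε₀ = ε₀`, `ε₂₉` are free letters.  NODE N09's roads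
([B11] Thm 1's regime `ε₀ ≤ a₀`, the two-radii binders at `(εreg, εbg)`: dag-n09-w1 `…N09BackgroundRadiiReg8OfThm1Objects` (`εreg ≤ εbg ≤ a₀`; LOCATED `not_εbg_le_a₀_theta13OfThm1CCMW`),
dag-n09-w4 `…N09TowerOfNumericsRunFree` (`36608·εbg ≤ 1∕3`, `64L²·εbg ≤ δ_N`, `2εbg ≤ ε₀L²` on the `huniq`-free door)) read `εbg` INSIDE print's regime — unsatisfiable at `εbg = 1`
(`36608 > 1∕3`; `1 ≤ a₀` false under the guard `217a₀ ≤ 2`); their located word: «the doors serve print-admissible re-keyings (`εbg := εreg = a₀` included)».  THIS FILE types that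
re-keying AS A LETTER: §1 `stage12NumericsOfThm1CCMWB L j γ εbg ε₀ B₃ B₃' a₀ a₁ := { stage12NumericsOfThm1CCMW … with εbg := εbg }` (faces; `_one` bridge `rfl`; sign windows `Pos` under
the one new sign `0 < εbg`); §2 the witness `theta13OfThm1CCMWZB F N j γ εbg ε₀ ε₂₉ B₃ B₃' a₀ a₁ Efl logz := theta13LiveOfNumericsZ F N (stage12NumericsOfThm1CCMWB …) …` (Z2's
`n`-generic family at the B numerics) with the BRIDGE `theta13OfThm1CCMWZ … = theta13OfThm1CCMWZB … 1 …` (`rfl`) and the print-regime member `εbg := a₀`; §3 faces by token-pass + the NEW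
face `_εbg = εbg`; §4 rows `HasResidualsOfRecord` (`⟨rfl,rfl,rfl⟩`), Z (`ZtUnity`), G (`Admissible` under the signs + `0 < εbg`), ★ P12 (`SlotsNondegenerate₁₃`) HYPOTHESIS-FREE — all by Z2's
`n`-generic theorems, hence LETTER-GENERIC in `εbg` with NO displayed hypothesis on it; §5 the N09 regime letters at the print-regime member: `εbg ≤ a₀` and `ν.εreg ≤ εbg` hold with
equality (`le_rfl`) — the two letters dag-n09-w1's LOCATED theorem shows FAIL at the `εbg = 1` members.

WHAT THIS FILE DOES NOT DO: it pins NO value of `εbg` (a LETTER; the print-regime member `εbg := a₀` is displayed as ONE specialisation, not chosen for anybody); proves NO N09 ∕ N13 row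
and NO proviso content (row P11 `bg` stays DISPLAYED, exactly as in Z2); touches NO registered text of K0⁷ stmt-QuantumFields-20541 (V20-G) or K1⁹ 27364 (v10); re-keys NO consumer
(the landed `theta13OfThm1CCMW(Z)` files are the `εbg = 1` instances by `rfl`).

HONEST FRAMING.  A DEFINITION edition + instantiation of Z2's generic rows; NOTHING of Bałaban's is asserted; no estimate; K0⁷ 20541 NOT discharged; K1⁹ 27364 ∕ K3⁸ 27366 OPEN; no node
count moves (typed 28∕28 · discharged 5∕27 (A 5∕28)); FLAG №7 (N09) untouched.  One finite four-torus programme at fixed `ε = L^{−K}` — NOT the continuum limit on ℝ⁴, NOT infinite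
volume, NOT OS, NOT a mass gap, NOT the Clay problem; R4 = the CONDITIONAL finite-𝕋⁴ rung `BalabanLadder.UV` only.  No `sorry`, no `axiom`, no `instance`, no `notation`.
-/

noncomputable section

open MeasureTheory
open scoped Matrix.Norms.L2Operator

namespace Literature.MathematicalPhysics.QuantumFieldTheory.Balaban1983to89.Node00

open T4Continuum AveragingRT T4FiniteEpsInhabited FlowStep FlowStepRuns DagBinding T4DatumAssembly B4GaugeCovariance

/-! ## §1. The windowed collared numerics WITH THE BACKGROUND RADIUS AS A LETTER: `stage12NumericsOfThm1CCMWB` -/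

section Numerics

variable (L j : ℕ) (γ εbg ε₀ B₃ B₃' a₀ a₁ : ℝ)

/-- **THE WINDOWED COLLARED STAGE-12 NUMERICS WITH THE BACKGROUND RADIUS `εbg` A LETTER**: `stage12NumericsOfThm1CCMW L j γ ε₀ B₃ B₃' a₀ a₁` (dag-n21-c A1ʷ: `M = M₁ = L^j`,
`A₀ = A₀ᶜᶜ¹`, `εreg = a₀`, `p₀ = r = 1`, `s2 = sect2NumericsOfThm1C L`, `A₁ = 1`, window `γ`) with `εbg := εbg` in place of the numerics-of-record pin `εbg = 1` — the background-field
regularity radius of [I] (0.21) («`U ∈ 𝔘_k(ε)` for ε small») as an open letter, to be chosen inside [B11] Thm 1's regime by its consumer. [cite: Balaban1987RG1, (0.21) p.256, (1.2) p.260, Thm 1 p.259; Balaban1985Variational, Thm 1 p.279; Balaban1988Convergent, (2.4) p.255, (2.10) p.256 (bookkeeping witness)] -/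
def stage12NumericsOfThm1CCMWB : Stage12Numerics :=
  { stage12NumericsOfThm1CCMW L j γ ε₀ B₃ B₃' a₀ a₁ with εbg := εbg }

/-- FACE (`rfl`): its background radius IS the letter. [cite: Balaban1987RG1, (0.21) p.256 (bookkeeping)] -/
theorem stage12NumericsOfThm1CCMWB_εbg : (stage12NumericsOfThm1CCMWB L j γ εbg ε₀ B₃ B₃' a₀ a₁).εbg = εbg := rfl

/-- **BRIDGE (`rfl`): the `εbg = 1` member IS A1ʷ's windowed collared numerics of record.** [cite: Balaban1987RG1, (0.21) p.256 (bookkeeping)] -/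
theorem stage12NumericsOfThm1CCMWB_one : stage12NumericsOfThm1CCMWB L j γ 1 ε₀ B₃ B₃' a₀ a₁ = stage12NumericsOfThm1CCMW L j γ ε₀ B₃ B₃' a₀ a₁ := rfl

/-- FACE (`rfl`): window letter. [cite: Balaban1987RG1, Thm 1 p.259 (bookkeeping)] -/
theorem stage12NumericsOfThm1CCMWB_γ : (stage12NumericsOfThm1CCMWB L j γ εbg ε₀ B₃ B₃' a₀ a₁).γ = γ := rfl

/-- FACE (`rfl`): its Stage-7 part IS the collared member's (`εbg`-blind). [cite: Balaban1988Convergent, (2.4) p.255 (bookkeeping)] -/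
theorem stage12NumericsOfThm1CCMWB_ν : (stage12NumericsOfThm1CCMWB L j γ εbg ε₀ B₃ B₃' a₀ a₁).ν = numerics7OfThm1CCM L j ε₀ B₃ B₃' a₀ a₁ := rfl

/-- FACE (`rfl`): its Stage-7 part IS the windowed member's. [cite: Balaban1988Convergent, (2.4) p.255 (bookkeeping)] -/
theorem stage12NumericsOfThm1CCMWB_ν_eq : (stage12NumericsOfThm1CCMWB L j γ εbg ε₀ B₃ B₃' a₀ a₁).ν = (stage12NumericsOfThm1CCMW L j γ ε₀ B₃ B₃' a₀ a₁).ν := rfl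

/-- FACE (`rfl`): cut-off radius `ν.εreg = a₀`. [cite: Balaban1985Variational, Thm 1 p.279; Balaban1987RG1, (1.2) p.260 (bookkeeping)] -/
theorem stage12NumericsOfThm1CCMWB_εreg : (stage12NumericsOfThm1CCMWB L j γ εbg ε₀ B₃ B₃' a₀ a₁).ν.εreg = a₀ := rfl

/-- FACE (`rfl`): small-field threshold `ν.ε₀ = ε₀`. [cite: Balaban1988Convergent, (2.4) p.255 (bookkeeping)] -/
theorem stage12NumericsOfThm1CCMWB_ε₀ : (stage12NumericsOfThm1CCMWB L j γ εbg ε₀ B₃ B₃' a₀ a₁).ν.ε₀ = ε₀ := rfl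

/-- FACE (`rfl`): `ν.A₀ = A₀ᶜᶜ¹`. [cite: Balaban1985Variational, Thm 1 p.279 (bookkeeping)] -/
theorem stage12NumericsOfThm1CCMWB_A₀ : (stage12NumericsOfThm1CCMWB L j γ εbg ε₀ B₃ B₃' a₀ a₁).ν.A₀ = A0OfThm1CC1 L B₃ B₃' a₀ a₁ := rfl

/-- FACE (`rfl`): separation width `ν.M₁ = L ^ j`. [cite: Balaban1985RegularSpaces, (1.3)–(1.6) p.77 (bookkeeping)] -/
theorem stage12NumericsOfThm1CCMWB_M₁ : (stage12NumericsOfThm1CCMWB L j γ εbg ε₀ B₃ B₃' a₀ a₁).ν.M₁ = L ^ j := rfl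

/-- FACE (`rfl`): tower numerics ARE the collared member's. [cite: Balaban1989LargeFieldI, (i)–(ii) p.177; Balaban1988Convergent, (2.1) p.254 (bookkeeping)] -/
theorem stage12NumericsOfThm1CCMWB_τ9 : (stage12NumericsOfThm1CCMWB L j γ εbg ε₀ B₃ B₃' a₀ a₁).τ9 = towerNumericsOfThm1CCM L j := rfl

/-- FACE (`rfl`): cube letter `τ9.M = L ^ j`. [cite: Balaban1989LargeFieldI, (i)–(ii) p.177; Balaban1988Convergent, (2.1) p.254; Balaban1987RG1, (1.12) p.262 (bookkeeping)] -/
theorem stage12NumericsOfThm1CCMWB_τ9_M : (stage12NumericsOfThm1CCMWB L j γ εbg ε₀ B₃ B₃' a₀ a₁).τ9.M = L ^ j := rfl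

/-- FACE (`rfl`): §2 numerics ARE `sect2NumericsOfThm1C L`. [cite: Balaban1988Convergent, (2.28) p.259 (bookkeeping)] -/
theorem stage12NumericsOfThm1CCMWB_s2 : (stage12NumericsOfThm1CCMWB L j γ εbg ε₀ B₃ B₃' a₀ a₁).s2 = sect2NumericsOfThm1C L := rfl

/-- FACE (`rfl`): `A₁ = 1`. [cite: Balaban1988Convergent, (3.16) p.268 (bookkeeping)] -/
theorem stage12NumericsOfThm1CCMWB_A₁ : (stage12NumericsOfThm1CCMWB L j γ εbg ε₀ B₃ B₃' a₀ a₁).A₁ = 1 := rfl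

/-- **THE SMALL-FIELD THRESHOLDS ARE `εbg`-BLIND**: `epsOfRecord` of the B numerics IS the unit branch's (`rfl`). [cite: Balaban1988Convergent, (2.4) p.255 (bookkeeping)] -/
theorem epsOfRecord_stage12NumericsOfThm1CCMWB :
    epsOfRecord (stage12NumericsOfThm1CCMWB L j γ εbg ε₀ B₃ B₃' a₀ a₁).ν = epsOfRecord (numerics7OfThm1CC1 L ε₀ B₃ B₃' a₀ a₁) := rfl

variable {L j γ εbg ε₀ B₃ B₃' a₀ a₁}

/-- **THE B NUMERICS MEET EVERY SIGN WINDOW** (`Stage12Numerics.Pos`) under `1 ≤ L`, `0 < γ < 1`, THE ONE NEW SIGN `0 < εbg`, `0 < ε₀`, `0 ≤ B₃`, `0 ≤ B₃′`, `0 < a₀`, `0 < a₁` (every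
other clause is A1ʷ's `stage12NumericsOfThm1CCMW_pos`). [cite: Balaban1988Convergent, (2.4) p.255, (2.10) p.256, (2.28) p.259, (2.34)–(2.39) p.261; Balaban1987RG1, Thm 1 p.259, (0.21) p.256; Balaban1985Variational, Thm 1 p.279 (bookkeeping)] -/
theorem stage12NumericsOfThm1CCMWB_pos (hL : 1 ≤ L) (hγ0 : 0 < γ) (hγ1 : γ < 1) (hbg : 0 < εbg) (hε : 0 < ε₀) (hB : 0 ≤ B₃) (hB' : 0 ≤ B₃') (ha₀ : 0 < a₀) (ha₁ : 0 < a₁) :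
    (stage12NumericsOfThm1CCMWB L j γ εbg ε₀ B₃ B₃' a₀ a₁).Pos := by
  obtain ⟨h1, -, h3, h4, h5, h6, h7, h8, h9⟩ := stage12NumericsOfThm1CCMW_pos (j := j) hL hγ0 hγ1 hε hB hB' ha₀ ha₁
  exact ⟨h1, hbg, h3, h4, h5, h6, h7, h8, h9⟩

/-- … in particular on the range `0 < γ ≤ ½` of the window letter. [cite: Balaban1987RG1, Thm 1 p.259 (bookkeeping)] -/
theorem stage12NumericsOfThm1CCMWB_pos_of_le_half (hL : 1 ≤ L) (hγ0 : 0 < γ) (hγ : γ ≤ 1 / 2) (hbg : 0 < εbg) (hε : 0 < ε₀) (hB : 0 ≤ B₃) (hB' : 0 ≤ B₃') (ha₀ : 0 < a₀)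
    (ha₁ : 0 < a₁) : (stage12NumericsOfThm1CCMWB L j γ εbg ε₀ B₃ B₃' a₀ a₁).Pos :=
  stage12NumericsOfThm1CCMWB_pos hL hγ0 (hγ.trans_lt (by norm_num)) hbg hε hB hB' ha₀ ha₁

/-- **THE PRINT-REGIME MEMBER `εbg := a₀` meets the sign windows under A1ʷ's signs alone** (`0 < a₀` serves twice). [cite: Balaban1985Variational, Thm 1 p.279; Balaban1987RG1, (0.21) p.256, (1.2) p.260 (bookkeeping)] -/
theorem stage12NumericsOfThm1CCMWB_pos_regime (hL : 1 ≤ L) (hγ0 : 0 < γ) (hγ1 : γ < 1) (hε : 0 < ε₀) (hB : 0 ≤ B₃) (hB' : 0 ≤ B₃') (ha₀ : 0 < a₀) (ha₁ : 0 < a₁) :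
    (stage12NumericsOfThm1CCMWB L j γ a₀ ε₀ B₃ B₃' a₀ a₁).Pos :=
  stage12NumericsOfThm1CCMWB_pos hL hγ0 hγ1 ha₀ hε hB hB' ha₀ ha₁

end Numerics

/-! ## §2. ★★ THE WITNESS `θ₁₅ᶜᶜᴹᵂᶻᴮ(j; γ; εbg) = theta13OfThm1CCMWZB …`, its bridge to Z2, and the print-regime member -/

section WitnessZB

variable (F : T4Family) (N : ℕ) [NeZero N] (j : ℕ) (γ εbg ε₀ ε₂₉ B₃ B₃' a₀ a₁ : ℝ) (Efl logz : B12.RunParams → ℕ → ℝ)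

/-- **THE WINDOWED COLLARED STAGE-13 z-WITNESS WITH THE BACKGROUND RADIUS A LETTER** `θ₁₅ᶜᶜᴹᵂᶻᴮ(j; γ; εbg; ε₀, ε₂₉; B₃, B₃′, a₀, a₁; Efl, logz)`: Z2's all-numerics family with the
letters `theta13LiveOfNumericsZ` AT `stage12NumericsOfThm1CCMWB F.L j γ εbg ε₀ B₃ B₃' a₀ a₁`, with K0b's residuals of record — A1ʷ's member with `εbg` open; at `εbg = 1` it IS Z2's
`θ₁₅ᶜᶜᴹᵂᶻ(j; γ)`. [cite: Balaban1989LargeFieldI, (0.3) p.176 and p.177; Balaban1987RG1, Thm 1 p.259, (0.21) p.256; Balaban1985Variational, Thm 1 p.279; Balaban1988Convergent, (1.15) p.249, (2.4) p.255, (2.10) p.256; Balaban1989LargeFieldII, (0.15) p.360 (bookkeeping witness)] -/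
def theta13OfThm1CCMWZB : Stage13Params F N :=
  theta13LiveOfNumericsZ F N (stage12NumericsOfThm1CCMWB F.L j γ εbg ε₀ B₃ B₃' a₀ a₁) ε₂₉
    (zeta316OfRecord F N (stage12NumericsOfThm1CCMWB F.L j γ εbg ε₀ B₃ B₃' a₀ a₁).ν (stage12NumericsOfThm1CCMWB F.L j γ εbg ε₀ B₃ B₃' a₀ a₁).τ9.M
      (stage12NumericsOfThm1CCMWB F.L j γ εbg ε₀ B₃ B₃' a₀ a₁).A₁)
    (RzOfRecord F N) (ZtOfRecord F N) Efl logz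

/-- Unfolding (`rfl`): the witness IS the member of Z2's live family at the B numerics. [cite: Balaban1989LargeFieldI, (0.3) p.176 (bookkeeping)] -/
theorem theta13OfThm1CCMWZB_eq :
    theta13OfThm1CCMWZB F N j γ εbg ε₀ ε₂₉ B₃ B₃' a₀ a₁ Efl logz =
      theta13LiveOfNumericsZ F N (stage12NumericsOfThm1CCMWB F.L j γ εbg ε₀ B₃ B₃' a₀ a₁) ε₂₉
        (zeta316OfRecord F N (stage12NumericsOfThm1CCMWB F.L j γ εbg ε₀ B₃ B₃' a₀ a₁).ν (stage12NumericsOfThm1CCMWB F.L j γ εbg ε₀ B₃ B₃' a₀ a₁).τ9.M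
          (stage12NumericsOfThm1CCMWB F.L j γ εbg ε₀ B₃ B₃' a₀ a₁).A₁)
        (RzOfRecord F N) (ZtOfRecord F N) Efl logz := rfl

/-- **BRIDGE (`rfl`): `theta13OfThm1CCMWZ = theta13OfThm1CCMWZB … (εbg := 1) …`** — every landed windowed z-witness IS the `εbg = 1` member (no consumer re-keys). [cite: Balaban1987RG1, (0.21) p.256; Balaban1989LargeFieldI, (0.3) p.176 (bookkeeping)] -/
theorem theta13OfThm1CCMWZ_eq_B :
    theta13OfThm1CCMWZ F N j γ ε₀ ε₂₉ B₃ B₃' a₀ a₁ Efl logz = theta13OfThm1CCMWZB F N j γ 1 ε₀ ε₂₉ B₃ B₃' a₀ a₁ Efl logz := rfl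

/-- **BRIDGE (`rfl`): A1ʷ's witness of record `theta13OfThm1CCMW = theta13OfThm1CCMWZB … 1 … 0 0`** (the `εbg = 1`, coupling-blind member). [cite: Balaban1987RG1, (0.21) p.256; Balaban1989LargeFieldI, (0.3) p.176 (bookkeeping)] -/
theorem theta13OfThm1CCMW_eq_B :
    theta13OfThm1CCMW F N j γ ε₀ ε₂₉ B₃ B₃' a₀ a₁ = theta13OfThm1CCMWZB F N j γ 1 ε₀ ε₂₉ B₃ B₃' a₀ a₁ (fun _ _ => 0) (fun _ _ => 0) := rfl

/-- **BRIDGE (`rfl`): A1's collared witness `theta13OfThm1CCMZ = theta13OfThm1CCMWZB … (γ := ½) (εbg := 1) …`.** [cite: Balaban1987RG1, Thm 1 p.259, (0.21) p.256 (bookkeeping)] -/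
theorem theta13OfThm1CCMZ_eq_B :
    theta13OfThm1CCMZ F N j ε₀ ε₂₉ B₃ B₃' a₀ a₁ Efl logz = theta13OfThm1CCMWZB F N j (1 / 2) 1 ε₀ ε₂₉ B₃ B₃' a₀ a₁ Efl logz := rfl

/-! ## §3. Faces at the witness (token-pass) + THE NEW LETTER FACE `_εbg` -/

/-- ★ FACE (`rfl`): **`θ₁₅ᶜᶜᴹᵂᶻᴮ.εbg = εbg`** — the background radius IS the letter. [cite: Balaban1987RG1, (0.21) p.256 (bookkeeping)] -/
theorem theta13OfThm1CCMWZB_εbg : (theta13OfThm1CCMWZB F N j γ εbg ε₀ ε₂₉ B₃ B₃' a₀ a₁ Efl logz).εbg = εbg := rfl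

/-- FACE (`rfl`): `Efl`. [cite: Balaban1988Convergent, (1.15) p.249 (bookkeeping)] -/
theorem theta13OfThm1CCMWZB_Efl : (theta13OfThm1CCMWZB F N j γ εbg ε₀ ε₂₉ B₃ B₃' a₀ a₁ Efl logz).Efl = Efl := rfl

/-- FACE (`rfl`): `logz`. [cite: Balaban1989LargeFieldII, (0.15) p.360 (bookkeeping)] -/
theorem theta13OfThm1CCMWZB_logz : (theta13OfThm1CCMWZB F N j γ εbg ε₀ ε₂₉ B₃ B₃' a₀ a₁ Efl logz).logz = logz := rfl

/-- FACE (`rfl`): window `γ`. [cite: Balaban1987RG1, Thm 1 p.259 (bookkeeping)] -/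
theorem theta13OfThm1CCMWZB_γ : (theta13OfThm1CCMWZB F N j γ εbg ε₀ ε₂₉ B₃ B₃' a₀ a₁ Efl logz).γ = γ := rfl

/-- FACE (`rfl`): Stage-7 numerics. [cite: Balaban1988Convergent, (2.4) p.255 (bookkeeping)] -/
theorem theta13OfThm1CCMWZB_ν : (theta13OfThm1CCMWZB F N j γ εbg ε₀ ε₂₉ B₃ B₃' a₀ a₁ Efl logz).ν = numerics7OfThm1CCM F.L j ε₀ B₃ B₃' a₀ a₁ := rfl

/-- FACE (`rfl`): the Stage-7 numerics ARE the `εbg = 1` member's (the letter is not a Stage-7 field). [cite: Balaban1988Convergent, (2.4) p.255 (bookkeeping)] -/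
theorem theta13OfThm1CCMWZB_ν_eq :
    (theta13OfThm1CCMWZB F N j γ εbg ε₀ ε₂₉ B₃ B₃' a₀ a₁ Efl logz).ν = (theta13OfThm1CCMWZ F N j γ ε₀ ε₂₉ B₃ B₃' a₀ a₁ Efl logz).ν := rfl

/-- FACE (`rfl`): cut-off radius `ν.εreg = a₀`. [cite: Balaban1985Variational, Thm 1 p.279; Balaban1987RG1, (1.2) p.260 (bookkeeping)] -/
theorem theta13OfThm1CCMWZB_εreg : (theta13OfThm1CCMWZB F N j γ εbg ε₀ ε₂₉ B₃ B₃' a₀ a₁ Efl logz).ν.εreg = a₀ := rfl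

/-- FACE (`rfl`): `ν.A₀ = A₀ᶜᶜ¹`. [cite: Balaban1985Variational, Thm 1 p.279 (bookkeeping)] -/
theorem theta13OfThm1CCMWZB_A₀ : (theta13OfThm1CCMWZB F N j γ εbg ε₀ ε₂₉ B₃ B₃' a₀ a₁ Efl logz).ν.A₀ = A0OfThm1CC1 F.L B₃ B₃' a₀ a₁ := rfl

/-- FACE (`rfl`): `ν.M₁ = F.L ^ j`. [cite: Balaban1985RegularSpaces, (1.3)–(1.6) p.77 (bookkeeping)] -/
theorem theta13OfThm1CCMWZB_M₁ : (theta13OfThm1CCMWZB F N j γ εbg ε₀ ε₂₉ B₃ B₃' a₀ a₁ Efl logz).ν.M₁ = F.L ^ j := rfl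

/-- FACE (`rfl`): `ν.M₂ = 1`. [cite: Balaban1988Convergent, (2.13)–(2.14) p.257 (bookkeeping)] -/
theorem theta13OfThm1CCMWZB_M₂ : (theta13OfThm1CCMWZB F N j γ εbg ε₀ ε₂₉ B₃ B₃' a₀ a₁ Efl logz).ν.M₂ = 1 := rfl

/-- FACE (`rfl`): `ν.p₀ = 1`. [cite: Balaban1988Convergent, (2.5) p.255 (bookkeeping)] -/
theorem theta13OfThm1CCMWZB_p₀ : (theta13OfThm1CCMWZB F N j γ εbg ε₀ ε₂₉ B₃ B₃' a₀ a₁ Efl logz).ν.p₀ = 1 := rfl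

/-- FACE (`rfl`): `ν.r = 1`. [cite: Balaban1988Convergent, (2.13)–(2.14) p.257 (bookkeeping)] -/
theorem theta13OfThm1CCMWZB_r : (theta13OfThm1CCMWZB F N j γ εbg ε₀ ε₂₉ B₃ B₃' a₀ a₁ Efl logz).ν.r = 1 := rfl

/-- FACE (`rfl`): small-field threshold `ν.ε₀ = ε₀`. [cite: Balaban1988Convergent, (2.4) p.255 (bookkeeping)] -/
theorem theta13OfThm1CCMWZB_ε₀ : (theta13OfThm1CCMWZB F N j γ εbg ε₀ ε₂₉ B₃ B₃' a₀ a₁ Efl logz).ν.ε₀ = ε₀ := rfl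

/-- FACE (`rfl`): the (2.9) letter. [cite: Balaban1987RG1, (2.9) p.266 (bookkeeping)] -/
theorem theta13OfThm1CCMWZB_ε₂₉ : (theta13OfThm1CCMWZB F N j γ εbg ε₀ ε₂₉ B₃ B₃' a₀ a₁ Efl logz).ε₂₉ = ε₂₉ := rfl

/-- FACE (`rfl`): §2 numerics. [cite: Balaban1988Convergent, (2.28) p.259 (bookkeeping)] -/
theorem theta13OfThm1CCMWZB_s2 : (theta13OfThm1CCMWZB F N j γ εbg ε₀ ε₂₉ B₃ B₃' a₀ a₁ Efl logz).s2 = sect2NumericsOfThm1C F.L := rfl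

/-- FACE (`rfl`): `s2.cB = 6L + 1`. [cite: Balaban1988Convergent, (2.28) p.259 (bookkeeping)] -/
theorem theta13OfThm1CCMWZB_cB : (theta13OfThm1CCMWZB F N j γ εbg ε₀ ε₂₉ B₃ B₃' a₀ a₁ Efl logz).s2.cB = 6 * F.L + 1 := rfl

/-- FACE (`rfl`): `s2.B = 7`. [cite: Balaban1988Convergent, (2.34) p.261 (bookkeeping)] -/
theorem theta13OfThm1CCMWZB_B : (theta13OfThm1CCMWZB F N j γ εbg ε₀ ε₂₉ B₃ B₃' a₀ a₁ Efl logz).s2.B = 7 := rfl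

/-- FACE (`rfl`): `s2.C = 1`. [cite: Balaban1988Convergent, (2.35) p.261 (bookkeeping)] -/
theorem theta13OfThm1CCMWZB_C : (theta13OfThm1CCMWZB F N j γ εbg ε₀ ε₂₉ B₃ B₃' a₀ a₁ Efl logz).s2.C = 1 := rfl

/-- FACE (`rfl`): `s2.Mr = 1`. [cite: Balaban1988Convergent, (2.36) p.261 (bookkeeping)] -/
theorem theta13OfThm1CCMWZB_Mr : (theta13OfThm1CCMWZB F N j γ εbg ε₀ ε₂₉ B₃ B₃' a₀ a₁ Efl logz).s2.Mr = 1 := rfl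

/-- FACE (`rfl`): `s2.cR = 1`. [cite: Balaban1988Convergent, (3.4) p.265 (bookkeeping)] -/
theorem theta13OfThm1CCMWZB_cR : (theta13OfThm1CCMWZB F N j γ εbg ε₀ ε₂₉ B₃ B₃' a₀ a₁ Efl logz).s2.cR = 1 := rfl

/-- FACE (`rfl`): `s2.βc = ¼`. [cite: Balaban1988Convergent, (2.38) p.261 (bookkeeping)] -/
theorem theta13OfThm1CCMWZB_βc : (theta13OfThm1CCMWZB F N j γ εbg ε₀ ε₂₉ B₃ B₃' a₀ a₁ Efl logz).s2.βc = 1 / 4 := rfl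

/-- FACE (`rfl`): `s2.lf.κ = 20000`. [cite: Balaban1987RG1, (0.25)–(0.26) p.257 (bookkeeping)] -/
theorem theta13OfThm1CCMWZB_κ : (theta13OfThm1CCMWZB F N j γ εbg ε₀ ε₂₉ B₃ B₃' a₀ a₁ Efl logz).s2.lf.κ = 20000 := rfl

/-- FACE (`rfl`): cube letter `τ9.M = F.L ^ j`. [cite: Balaban1989LargeFieldI, (i)–(ii) p.177; Balaban1988Convergent, (2.1) p.254; Balaban1987RG1, (1.12) p.262 (bookkeeping)] -/
theorem theta13OfThm1CCMWZB_τ9_M : (theta13OfThm1CCMWZB F N j γ εbg ε₀ ε₂₉ B₃ B₃' a₀ a₁ Efl logz).τ9.M = F.L ^ j := rfl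

/-- FACE (`rfl`): `A₁ = 1`. [cite: Balaban1988Convergent, (3.16) p.268 (bookkeeping)] -/
theorem theta13OfThm1CCMWZB_A₁ : (theta13OfThm1CCMWZB F N j γ εbg ε₀ ε₂₉ B₃ B₃' a₀ a₁ Efl logz).A₁ = 1 := rfl

/-- FACE (`rfl`): `Rz = RzOfRecord`. [cite: Balaban1988Convergent, (2.21) p.258 (bookkeeping)] -/
theorem theta13OfThm1CCMWZB_Rz : (theta13OfThm1CCMWZB F N j γ εbg ε₀ ε₂₉ B₃ B₃' a₀ a₁ Efl logz).Rz = RzOfRecord F N := rfl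

/-- … block size of the family: `ℓ₆ + 1 = F.L`. [cite: Balaban1987RG1, (0.1) p.251 (bookkeeping)] -/
theorem theta13OfThm1CCMWZB_ℓ₆_succ : (theta13OfThm1CCMWZB F N j γ εbg ε₀ ε₂₉ B₃ B₃' a₀ a₁ Efl logz).ℓ₆ + 1 = F.L := stage3OfFamily_ℓ₆_succ F

/-- N10's Lemma-3 level-T binder: `8 ≤ θ.ℓ₆ + 1`. [cite: Balaban1987RG1, (0.1) p.251; Balaban1988RG2Cluster, (2.36) p.19] -/
theorem eight_le_L_theta13OfThm1CCMWZB : 8 ≤ (theta13OfThm1CCMWZB F N j γ εbg ε₀ ε₂₉ B₃ B₃' a₀ a₁ Efl logz).ℓ₆ + 1 := eight_le_L_stage3OfFamily F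

/-- Row N1: the (D4) `tree` numeral. [cite: Balaban1987RG1, (0.25)–(0.26) p.257] -/
theorem kp_tree_theta13OfThm1CCMWZB : 128 * Real.log 162 ≤ (theta13OfThm1CCMWZB F N j γ εbg ε₀ ε₂₉ B₃ B₃' a₀ a₁ Efl logz).s2.lf.κ := kp_tree_lfConstsOfFamily

/-- Row N1: the (D4) `large` numeral at the family's block size. [cite: Balaban1987RG1, (0.25)–(0.26) p.257; Balaban1988RG2Cluster, p.21 (after (2.39))] -/
theorem kp_large_theta13OfThm1CCMWZB :
    10 * (64 * Real.log 162 + 1) ≤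
      (((((theta13OfThm1CCMWZB F N j γ εbg ε₀ ε₂₉ B₃ B₃' a₀ a₁ Efl logz).ℓ₆ + 1 : ℕ) : ℝ)) / 2 - 1) *
        (theta13OfThm1CCMWZB F N j γ εbg ε₀ ε₂₉ B₃ B₃' a₀ a₁ Efl logz).s2.lf.κ :=
  kp_large_theta13OfThm1CCM F N j ε₀ ε₂₉ B₃ B₃' a₀ a₁

/-- Row N1: N10's rate threshold. [cite: Balaban1987RG1, (1.18) p.263 (bookkeeping numeral)] -/
theorem kp_n10_theta13OfThm1CCMWZB : (2 * 10 ^ 4 : ℝ) ≤ (theta13OfThm1CCMWZB F N j γ εbg ε₀ ε₂₉ B₃ B₃' a₀ a₁ Efl logz).s2.lf.κ := kp_n10_lfConstsOfFamily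

/-! ## §4. Rows `HasResidualsOfRecord` ∕ Z ∕ G ∕ P12 at the witness — by Z2's `n`-generic theorems (letter-generic in `εbg`) -/

/-- `θ₁₅ᶜᶜᴹᵂᶻᴮ` carries K0b's residuals of record (`⟨rfl, rfl, rfl⟩`; the letter is not read). [cite: Balaban1988Convergent, (3.16) p.268, (2.21) p.258, (3.20) p.269 (bookkeeping)] -/
theorem hasResidualsOfRecord_theta13OfThm1CCMWZB : (theta13OfThm1CCMWZB F N j γ εbg ε₀ ε₂₉ B₃ B₃' a₀ a₁ Efl logz).HasResidualsOfRecord F N :=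
  hasResidualsOfRecord_theta13LiveOfNumericsZ F N (stage12NumericsOfThm1CCMWB F.L j γ εbg ε₀ B₃ B₃' a₀ a₁) ε₂₉ Efl logz

/-- **Row Z (`ZtUnity`) at `θ₁₅ᶜᶜᴹᵂᶻᴮ`.** [cite: Balaban1988Convergent, (3.16)–(3.20) pp.268–269] -/
theorem ztUnity_theta13OfThm1CCMWZB : (theta13OfThm1CCMWZB F N j γ εbg ε₀ ε₂₉ B₃ B₃' a₀ a₁ Efl logz).ZtUnity F N :=
  ztUnity_theta13LiveOfNumericsZ F N (stage12NumericsOfThm1CCMWB F.L j γ εbg ε₀ B₃ B₃' a₀ a₁) ε₂₉ Efl logz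

variable {j γ εbg ε₀ ε₂₉ B₃ B₃' a₀ a₁} in
/-- **Row G: `θ₁₅ᶜᶜᴹᵂᶻᴮ` IS STAGE-13 ADMISSIBLE under `0 < γ < 1`, THE NEW SIGN `0 < εbg`, and the signs `0 < ε₀`, `0 < ε₂₉`, `0 ≤ B₃`, `0 ≤ B₃′`, `0 < a₀`, `0 < a₁`** — whatever the
letters `Efl`, `logz`. [cite: Balaban1987RG1, Thm 1 p.259, (0.21) p.256, (2.9) p.266; Balaban1988Convergent, (2.10) p.256 (bookkeeping)] -/
theorem admissible_theta13OfThm1CCMWZB (hγ0 : 0 < γ) (hγ1 : γ < 1) (hbg : 0 < εbg) (hε : 0 < ε₀) (hε' : 0 < ε₂₉) (hB : 0 ≤ B₃) (hB' : 0 ≤ B₃') (ha₀ : 0 < a₀) (ha₁ : 0 < a₁) :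
    (theta13OfThm1CCMWZB F N j γ εbg ε₀ ε₂₉ B₃ B₃' a₀ a₁ Efl logz).Admissible F N :=
  admissible_theta13LiveOfNumericsZ F N _ _ _ Efl logz (stage12NumericsOfThm1CCMWB_pos F.hL.2.le hγ0 hγ1 hbg hε hB hB' ha₀ ha₁) hε'

variable {j γ εbg ε₀ ε₂₉ B₃ B₃' a₀ a₁} in
/-- … in particular on the range `0 < γ ≤ ½` of the window letter. [cite: Balaban1987RG1, Thm 1 p.259 (bookkeeping)] -/
theorem admissible_theta13OfThm1CCMWZB_of_le_half (hγ0 : 0 < γ) (hγ : γ ≤ 1 / 2) (hbg : 0 < εbg) (hε : 0 < ε₀) (hε' : 0 < ε₂₉) (hB : 0 ≤ B₃) (hB' : 0 ≤ B₃') (ha₀ : 0 < a₀)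
    (ha₁ : 0 < a₁) : (theta13OfThm1CCMWZB F N j γ εbg ε₀ ε₂₉ B₃ B₃' a₀ a₁ Efl logz).Admissible F N :=
  admissible_theta13OfThm1CCMWZB F N Efl logz hγ0 (hγ.trans_lt (by norm_num)) hbg hε hε' hB hB' ha₀ ha₁

variable {j γ ε₀ ε₂₉ B₃ B₃' a₀ a₁} in
/-- **Row G at THE PRINT-REGIME MEMBER `εbg := a₀`** under A1ʷ's signs alone. [cite: Balaban1985Variational, Thm 1 p.279; Balaban1987RG1, (0.21) p.256, (1.2) p.260 (bookkeeping)] -/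
theorem admissible_theta13OfThm1CCMWZB_regime (hγ0 : 0 < γ) (hγ1 : γ < 1) (hε : 0 < ε₀) (hε' : 0 < ε₂₉) (hB : 0 ≤ B₃) (hB' : 0 ≤ B₃') (ha₀ : 0 < a₀) (ha₁ : 0 < a₁) :
    (theta13OfThm1CCMWZB F N j γ a₀ ε₀ ε₂₉ B₃ B₃' a₀ a₁ Efl logz).Admissible F N :=
  admissible_theta13OfThm1CCMWZB F N Efl logz hγ0 hγ1 ha₀ hε hε' hB hB' ha₀ ha₁

/-- **★ Row P12 at `θ₁₅ᶜᶜᴹᵂᶻᴮ` HYPOTHESIS-FREE, LETTER-GENERIC** (Z2's `slotsNondegenerate₁₃_theta13LiveOfNumericsZ_of_hasResiduals`). [cite: Balaban1988Convergent, (3.22) p.269, (3.24) p.270; Balaban1989LargeFieldI, (0.3)–(0.4) p.176] -/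
theorem slotsNondegenerate₁₃_theta13OfThm1CCMWZB : (theta13OfThm1CCMWZB F N j γ εbg ε₀ ε₂₉ B₃ B₃' a₀ a₁ Efl logz).SlotsNondegenerate₁₃ F N :=
  slotsNondegenerate₁₃_theta13LiveOfNumericsZ_of_hasResiduals F N (stage12NumericsOfThm1CCMWB F.L j γ εbg ε₀ B₃ B₃' a₀ a₁) ε₂₉ Efl logz

/-- Row P12 at `θ₁₅ᶜᶜᴹᵂᶻᴮ` from `Provisos₁₃` there (the proviso-keyed form some consumers hold). [cite: Balaban1988Convergent, (3.22) p.269; Balaban1989LargeFieldI, (0.3)–(0.4) p.176] -/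
theorem slotsNondegenerate₁₃_theta13OfThm1CCMWZB_of_provisos (h : (theta13OfThm1CCMWZB F N j γ εbg ε₀ ε₂₉ B₃ B₃' a₀ a₁ Efl logz).Provisos₁₃ F N) :
    (theta13OfThm1CCMWZB F N j γ εbg ε₀ ε₂₉ B₃ B₃' a₀ a₁ Efl logz).SlotsNondegenerate₁₃ F N :=
  slotsNondegenerate₁₃_theta13LiveOfNumericsZ F N _ _ _ _ _ Efl logz h

/-! ## §5. The N09 regime letters at the witness: what the letter buys (the two letters dag-n09-w1's LOCATED theorem shows FAIL at `εbg = 1`) -/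

/-- **AT THE PRINT-REGIME MEMBER `εbg := a₀`: `θ.εbg ≤ a₀`** ([B11] Thm 1's regime letter of `…N09BackgroundRadiiReg8OfThm1Objects.hreg8_of_thm1Objects_of_ukRows`; compare its LOCATED
`not_εbg_le_a₀_theta13OfThm1CCMW` at the `εbg = 1` members). [cite: Balaban1985Variational, Thm 1 p.279; Balaban1987RG1, (1.2) p.260 (bookkeeping)] -/
theorem εbg_le_a₀_theta13OfThm1CCMWZB_regime : (theta13OfThm1CCMWZB F N j γ a₀ ε₀ ε₂₉ B₃ B₃' a₀ a₁ Efl logz).εbg ≤ a₀ := le_rfl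

/-- **AT THE PRINT-REGIME MEMBER: `ν.εreg ≤ θ.εbg`** (the two-radii letter `εreg ≤ εbg` of N09's roads, with equality). [cite: Balaban1985Variational, Thm 1 (8) p.279; Balaban1987RG1, (0.21) p.256, (1.2) p.260 (bookkeeping)] -/
theorem εreg_le_εbg_theta13OfThm1CCMWZB_regime :
    (theta13OfThm1CCMWZB F N j γ a₀ ε₀ ε₂₉ B₃ B₃' a₀ a₁ Efl logz).ν.εreg ≤ (theta13OfThm1CCMWZB F N j γ a₀ ε₀ ε₂₉ B₃ B₃' a₀ a₁ Efl logz).εbg := le_rfl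

variable {εbg a₀} in
/-- **AT A GENERAL MEMBER: the two regime letters read on the free pair `(a₀, εbg)`** — `ν.εreg ≤ θ.εbg ≤ a₀` iff `a₀ ≤ εbg ≤ a₀`, i.e. exactly at `εbg = a₀`; displayed as the
implication the consumer uses. [cite: Balaban1985Variational, Thm 1 p.279; Balaban1987RG1, (0.21) p.256, (1.2) p.260 (bookkeeping)] -/
theorem regimeLetters_theta13OfThm1CCMWZB (h₁ : a₀ ≤ εbg) (h₂ : εbg ≤ a₀) :
    (theta13OfThm1CCMWZB F N j γ εbg ε₀ ε₂₉ B₃ B₃' a₀ a₁ Efl logz).ν.εreg ≤ (theta13OfThm1CCMWZB F N j γ εbg ε₀ ε₂₉ B₃ B₃' a₀ a₁ Efl logz).εbg ∧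
      (theta13OfThm1CCMWZB F N j γ εbg ε₀ ε₂₉ B₃ B₃' a₀ a₁ Efl logz).εbg ≤ a₀ :=
  ⟨h₁, h₂⟩

end WitnessZB

end Literature.MathematicalPhysics.QuantumFieldTheory.Balaban1983to89.Node00

end
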